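import Literature.Analysis.FluidPDE.CompressibleEulerImplosionOriginSeriesTM
import HarnessLib

/-!
# Buckmaster–Cao-Labora–Gómez-Serrano at `γ = 5/3`: the sharp restarted majorant of the centre series

Companion of `CompressibleEulerImplosionOriginSeries` / `…OriginSeriesTM`. The Catalan majorant of the tree
(`abs_w_succ_le`, `abs_w_le`: `|wₙ| ≤ K₀M₀ⁿ`, radius `1/(2M₀) ≈ 1/224`) is far too crude for the centre expansion
of the pinned profile (clause (d) of the cavity tube needs the series up to `|ζ| ≈ 0.33`). This file provides
the SHARP step inequality of the recursion (2.12) with its exact weights,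

  `|w_{n+1}| ≤ 3/(n+1+πₙ) · ( (|r−1| + |2−r|·n)|wₙ| + Σ_{0<k<n} c_{k+1}|w_{k+1}|(n−k)|w_{n−k}| + (πₙ/6) Σ_{k<n} |w_{k+1}||w_{n−k}| )`

(`πₙ = 1 − (−1)ⁿ⁺¹ ∈ {0, 2}`; the `k = 0` term `v₁·n·wₙ` is kept with its TRUE coefficient `v₁ = 1 + w₁ = 2 − r`,
not `1 + |w₁| = r` — this is what makes the majorant radius `0.352` instead of `0.29`; `abs_w_succ_le_sharp`), and
the RESTARTED SCALAR MAJORANT: given integer data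
`H = [H₀, …, H_N]` dominating `|w_j(r)|·2^P/3^j` on a window `|r − 1| ≤ ρ̄`, the computable integer recursion
`H = [H₀, …, H_N]` and `|2 − r| ≤ ν̄`, the computable integer recursion `majList` (ceiling roundings only,
`Numerics.cdiv`) extends it to all orders, and `abs_w_le_majList` proves `|w_j(r)|·2^P ≤ M_j·3^j` for every listed `j`
(strong induction on the sharp step; all coefficients of the majorant recursion are non-negative). Kernel-evaluable (`decide`); the head data come from the Taylor-model
certificates (`…CentreCoeffWindow2`). No facts, no axioms.

[cite: BuckmasterCaolaboraGomezserrano2025, Prop. 2.5, eq. (2.12), App. B]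
-/

namespace Literature.Analysis.FluidPDE

namespace BuckmasterCaolaboraGomezserrano2025

namespace OriginSeries

open Finset
open Literature.Analysis.ValidatedNumerics

/-! ### The sharp step inequality -/

/-- [folklore] -/
theorem cc_nonneg (i : ℕ) : 0 ≤ cc i := by unfold cc; split_ifs <;> norm_num

/-- [folklore] -/
theorem par_nonneg_real (n : ℕ) : (0 : ℝ) ≤ 1 - (-1) ^ (n + 1) := by
  rw [← par_cast]; positivity

/-- **The sharp step of the majorant** (`A = 1`): the recursion (2.12) solved for `w_{n+1}`, estimated
termwise with its exact weights; the `k = 0` term carries the true coefficient `v₁ = 2 − r`.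
[cite: BuckmasterCaolaboraGomezserrano2025, eq. (2.12), proof of Prop. 2.5] -/
theorem abs_w_succ_le_sharp (r : ℝ) (n : ℕ) :
    |w r 1 (n + 1)| ≤ 3 / ((n : ℝ) + 1 + (par n : ℕ)) *
      ((|r - 1| + |2 - r| * n) * |w r 1 n|
        + (∑ k ∈ range n, (if k = 0 then (0 : ℝ) else cc (k + 1) * |w r 1 (k + 1)|)
            * ((n - k : ℕ) : ℝ) * |w r 1 (n - k)|)
        + ((par n : ℕ) : ℝ) / 6 * ∑ k ∈ range n, |w r 1 (k + 1)| * |w r 1 (n - k)|) := by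
  have hp : ((par n : ℕ) : ℝ) = 1 - (-1) ^ (n + 1) := par_cast n
  have hp0 : (0 : ℝ) ≤ ((par n : ℕ) : ℝ) := by positivity
  have hw1 : w r 1 1 = 1 - r := w_one one_ne_zero
  -- the three terms of `rest`
  have h1 : |(r - 1) * w r 1 n| = |r - 1| * |w r 1 n| := abs_mul _ _
  have h2 : |∑ k ∈ range n, vv (w r 1) (k + 1) * dd (w r 1) (n - (k + 1))|
      ≤ |2 - r| * n * |w r 1 n| + ∑ k ∈ range n, (if k = 0 then (0 : ℝ) else cc (k + 1) * |w r 1 (k + 1)|)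
            * ((n - k : ℕ) : ℝ) * |w r 1 (n - k)| := by
    refine (abs_sum_le_sum_abs _ _).trans ?_
    have hterm : ∀ k ∈ range n, |vv (w r 1) (k + 1) * dd (w r 1) (n - (k + 1))|
        ≤ (if k = 0 then |2 - r| * n * |w r 1 n| else 0)
          + (if k = 0 then (0 : ℝ) else cc (k + 1) * |w r 1 (k + 1)|) * ((n - k : ℕ) : ℝ) * |w r 1 (n - k)| := by
      intro k hk
      rw [mem_range] at hk
      have hidx : n - (k + 1) + 1 = n - k := by omega
      have hcast : ((n - (k + 1) : ℕ) : ℝ) + 1 = ((n - k : ℕ) : ℝ) := by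
        have : (n - (k + 1) : ℕ) + 1 = n - k := hidx
        exact_mod_cast this
      have hd : |dd (w r 1) (n - (k + 1))| = ((n - k : ℕ) : ℝ) * |w r 1 (n - k)| := by
        unfold dd
        rw [abs_mul, hidx, ← hcast, abs_of_nonneg (by positivity)]
      rw [abs_mul, hd]
      by_cases hk0 : k = 0
      · subst hk0
        have hv : |vv (w r 1) (0 + 1)| = |2 - r| := by
          unfold vv cc
          rw [show (0 + 1 : ℕ) = 1 from rfl, if_pos rfl, if_neg (by decide), hw1]
          ring_nf
        rw [hv, if_pos rfl, if_pos rfl]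
        simp only [Nat.sub_zero, zero_mul, add_zero]
        ring_nf; rfl
      · rw [if_neg hk0, if_neg hk0, zero_add]
        have hv : |vv (w r 1) (k + 1)| ≤ cc (k + 1) * |w r 1 (k + 1)| := by
          unfold vv
          rw [if_neg (by omega : ¬ (k + 1 = 1)), zero_add, abs_mul, abs_of_nonneg (cc_nonneg _)]
        have hnn : 0 ≤ ((n - k : ℕ) : ℝ) * |w r 1 (n - k)| := by positivity
        calc |vv (w r 1) (k + 1)| * (((n - k : ℕ) : ℝ) * |w r 1 (n - k)|)
            ≤ (cc (k + 1) * |w r 1 (k + 1)|) * (((n - k : ℕ) : ℝ) * |w r 1 (n - k)|) :=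
              mul_le_mul_of_nonneg_right hv hnn
          _ = _ := by ring
    refine (sum_le_sum hterm).trans ?_
    rw [sum_add_distrib, sum_ite_eq']
    by_cases hn : n = 0
    · subst hn; simp
    · rw [if_pos (mem_range.mpr (Nat.pos_of_ne_zero hn))]
  have h3 : |1 / 6 * (1 - (-1) ^ (n + 1)) * ∑ k ∈ range n, w r 1 (k + 1) * w r 1 (n - k)|
      ≤ ((par n : ℕ) : ℝ) / 6 * ∑ k ∈ range n, |w r 1 (k + 1)| * |w r 1 (n - k)| := by
    rw [abs_mul, ← hp]
    have hc : |1 / 6 * ((par n : ℕ) : ℝ)| = ((par n : ℕ) : ℝ) / 6 := by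
      rw [abs_of_nonneg (by positivity)]; ring
    rw [hc]
    refine mul_le_mul_of_nonneg_left ?_ (by positivity)
    refine (abs_sum_le_sum_abs _ _).trans (sum_le_sum fun k _ => ?_)
    rw [abs_mul]
  have hrest : |rest r (w r 1) n| ≤ (|r - 1| + |2 - r| * n) * |w r 1 n|
        + (∑ k ∈ range n, (if k = 0 then (0 : ℝ) else cc (k + 1) * |w r 1 (k + 1)|)
            * ((n - k : ℕ) : ℝ) * |w r 1 (n - k)|)
        + ((par n : ℕ) : ℝ) / 6 * ∑ k ∈ range n, |w r 1 (k + 1)| * |w r 1 (n - k)| := by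
    unfold rest
    refine (abs_add_three _ _ _).trans ?_
    rw [h1]
    have := add_le_add (add_le_add (le_refl (|r - 1| * |w r 1 n|)) h2) h3
    linarith
  -- `|w_{n+1}| = |rest| / lead`, `lead = (n + 1 + par n)/3 > 0`
  have hl : lead (w r 1) n = ((n : ℝ) + 1 + (par n : ℕ)) / 3 := by
    rw [lead_w, hp]; ring
  have hlpos : (0 : ℝ) < (n : ℝ) + 1 + (par n : ℕ) := by positivity
  rw [w_succ]
  unfold next
  rw [abs_div, abs_neg, hl, abs_of_pos (show (0 : ℝ) < ((n : ℝ) + 1 + (par n : ℕ)) / 3 by positivity),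
    div_div_eq_mul_div]
  rw [div_le_iff₀ hlpos]
  calc |rest r (w r 1) n| * 3 ≤ ((|r - 1| + |2 - r| * n) * |w r 1 n|
        + (∑ k ∈ range n, (if k = 0 then (0 : ℝ) else cc (k + 1) * |w r 1 (k + 1)|)
            * ((n - k : ℕ) : ℝ) * |w r 1 (n - k)|)
        + ((par n : ℕ) : ℝ) / 6 * ∑ k ∈ range n, |w r 1 (k + 1)| * |w r 1 (n - k)|) * 3 := by
        gcongr
    _ = _ := by field_simp

/-! ### The integer scalar majorant -/

/-- Entry `i` of an integer list (`0` past the end). [folklore] -/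
def getZ (L : List ℤ) (i : ℕ) : ℤ := L.getD i 0

/-- `3·cᵢ ∈ {1, 3}` as an integer. [folklore] -/
def cc3 (i : ℕ) : ℤ := if i % 2 = 0 then 1 else 3

/-- [folklore] -/
theorem cc3_cast (i : ℕ) : ((cc3 i : ℤ) : ℝ) = 3 * cc i := by
  unfold cc3 cc
  by_cases hi : i % 2 = 0
  · rw [if_pos hi, if_pos (Nat.even_iff.mpr hi)]; norm_num
  · rw [if_neg hi, if_neg (fun he => hi (Nat.even_iff.mp he))]; norm_num

/-- `πₙ/2 ∈ {0, 1}` as an integer. [folklore] -/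
def par2 (n : ℕ) : ℤ := if n % 2 = 0 then 1 else 0

/-- [folklore] -/
theorem par2_cast (n : ℕ) : ((par2 n : ℤ) : ℝ) = ((par n : ℕ) : ℝ) / 2 := by
  unfold par2 par
  by_cases hn : n % 2 = 0
  · rw [if_pos hn, if_pos hn]; norm_num
  · rw [if_neg hn, if_neg hn]; norm_num

/-- Recursive finite sum of integers (kernel friendly). [folklore] -/
def sumZ (g : ℕ → ℤ) : ℕ → ℤ
  | 0 => 0
  | n + 1 => sumZ g n + g n

/-- [folklore] -/
theorem sumZ_eq (g : ℕ → ℤ) : ∀ n, sumZ g n = ∑ k ∈ range n, g k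
  | 0 => by simp [sumZ]
  | n + 1 => by rw [sumZ, sumZ_eq g n, sum_range_succ]

/-- The quadratic part of the majorant step in rescaled integer units:
`Σ_{k<n} (𝟙_{k>0}·3c_{k+1}(n−k) + πₙ/2) · L_{k+1} L_{n−k}`. [cite: BuckmasterCaolaboraGomezserrano2025, eq. (2.12)] -/
def quadZ (L : List ℤ) (n : ℕ) : ℤ :=
  sumZ (fun k => ((if k = 0 then 0 else cc3 (k + 1) * ((n - k : ℕ) : ℤ)) + par2 n)
    * (getZ L (k + 1) * getZ L (n - k))) n

/-- **The majorant step** in rescaled integer units (`T_j ≥ |w_j| 2^P / 3^j`):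
`T_{n+1} = ⌈(⌈(ρn + n·νn) T_n / d⌉ + ⌈quad / 2^P⌉) / (n + 1 + πₙ)⌉`, `ρn/d ≥ |r − 1|`, `νn/d ≥ |2 − r|`.
[cite: BuckmasterCaolaboraGomezserrano2025, eq. (2.12), proof of Prop. 2.5] -/
def stepZ (ρn νn d P : ℕ) (L : List ℤ) (n : ℕ) : ℤ :=
  Numerics.cdiv (Numerics.cdiv (((ρn : ℤ) + (n : ℤ) * νn) * getZ L n) d + Numerics.cdiv (quadZ L n) ((2 : ℤ) ^ P))
    ((n : ℤ) + 1 + par n)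

/-- **The restarted scalar majorant**: the head data `H` extended by `m` majorant steps.
[cite: BuckmasterCaolaboraGomezserrano2025, proof of Prop. 2.5] -/
def majList (ρn νn d P : ℕ) (H : List ℤ) : ℕ → List ℤ
  | 0 => H
  | m + 1 => majList ρn νn d P H m ++ [stepZ ρn νn d P (majList ρn νn d P H m) ((majList ρn νn d P H m).length - 1)]

variable {ρn νn d P : ℕ} {H : List ℤ}

/-- [folklore] -/
theorem length_majList : ∀ m, (majList ρn νn d P H m).length = H.length + m
  | 0 => rfl
  | m + 1 => by simp [majList, length_majList m]; omega

/-- [folklore] -/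
theorem getZ_majList_of_lt {m i : ℕ} (hi : i < H.length + m) :
    getZ (majList ρn νn d P H (m + 1)) i = getZ (majList ρn νn d P H m) i := by
  unfold getZ
  simp only [majList]
  rw [List.getD_eq_getElem?_getD, List.getD_eq_getElem?_getD,
    List.getElem?_append_left (by rw [length_majList]; exact hi)]

/-- [folklore] -/
theorem getZ_majList_last (m : ℕ) :
    getZ (majList ρn νn d P H (m + 1)) (H.length + m) =
      stepZ ρn νn d P (majList ρn νn d P H m) (H.length + m - 1) := by
  unfold getZ
  simp only [majList]
  rw [List.getD_eq_getElem?_getD, List.getElem?_append_right (by rw [length_majList])]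
  simp [length_majList]

/-- The real inequality behind one majorant step. [cite: BuckmasterCaolaboraGomezserrano2025, proof of Prop. 2.5] -/
theorem abs_w_succ_le_stepZ {r : ℝ} (hd : 0 < d) (hr : |r - 1| ≤ (ρn : ℝ) / d) (hν : |2 - r| ≤ (νn : ℝ) / d)
    {L : List ℤ} {n : ℕ} (hL : ∀ i, i ≤ n → |w r 1 i| * (2 : ℝ) ^ P ≤ (getZ L i : ℝ) * (3 : ℝ) ^ i) :
    |w r 1 (n + 1)| * (2 : ℝ) ^ P ≤ (stepZ ρn νn d P L n : ℝ) * (3 : ℝ) ^ (n + 1) := by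
  set a : ℕ → ℝ := fun i => |w r 1 i| with ha
  set ℓ : ℕ → ℝ := fun i => (getZ L i : ℝ) * (3 : ℝ) ^ i / (2 : ℝ) ^ P with hℓ
  have h2P : (0 : ℝ) < (2 : ℝ) ^ P := by positivity
  have haℓ : ∀ i, i ≤ n → a i ≤ ℓ i := fun i hi => by
    simp only [ha, hℓ]; rw [le_div_iff₀ h2P]; exact hL i hi
  have ha0 : ∀ i, 0 ≤ a i := fun i => abs_nonneg _
  have hℓ0 : ∀ i, i ≤ n → 0 ≤ ℓ i := fun i hi => (ha0 i).trans (haℓ i hi)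
  have hstep := abs_w_succ_le_sharp r n
  have hp0 : (0 : ℝ) ≤ ((par n : ℕ) : ℝ) := by positivity
  have hden : (0 : ℝ) < (n : ℝ) + 1 + (par n : ℕ) := by positivity
  -- bound the bracket `B` by `3^n · (X + Q / 2^P) / 2^P`-type quantities
  -- (1) the linear part: |r-1| a n + (k = 0 term) n a n ≤ (ρn/ρd + n) ℓ n
  -- (2) the cc part and (3) the parity part: ≤ quadZ · 3^n / 2^(2P)
  have hlin : (|r - 1| + |2 - r| * n) * |w r 1 n| ≤ ((ρn : ℝ) / d + (νn : ℝ) / d * n) * ℓ n := by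
    refine mul_le_mul ?_ (haℓ n le_rfl) (abs_nonneg _) (by positivity)
    exact add_le_add hr (mul_le_mul_of_nonneg_right hν (by positivity))
  -- the middle sum
  have hmid : (∑ k ∈ range n, (if k = 0 then (0 : ℝ) else cc (k + 1) * |w r 1 (k + 1)|)
        * ((n - k : ℕ) : ℝ) * |w r 1 (n - k)|)
      ≤ ∑ k ∈ range n, (if k = 0 then (0 : ℝ) else cc (k + 1) * ((n - k : ℕ) : ℝ)) * (ℓ (k + 1) * ℓ (n - k)) := by
    refine sum_le_sum fun k hk => ?_
    rw [mem_range] at hk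
    by_cases hk0 : k = 0
    · rw [if_pos hk0, if_pos hk0]; simp
    · rw [if_neg hk0, if_neg hk0]
      have hcc := cc_nonneg (k + 1)
      have e : cc (k + 1) * |w r 1 (k + 1)| * ((n - k : ℕ) : ℝ) * |w r 1 (n - k)|
          = cc (k + 1) * ((n - k : ℕ) : ℝ) * (a (k + 1) * a (n - k)) := by simp only [ha]; ring
      rw [e]
      refine mul_le_mul_of_nonneg_left ?_ (by positivity)
      exact mul_le_mul (haℓ (k + 1) (by omega)) (haℓ (n - k) (by omega)) (ha0 _) (hℓ0 (k + 1) (by omega))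
  have hpar : ((par n : ℕ) : ℝ) / 6 * ∑ k ∈ range n, |w r 1 (k + 1)| * |w r 1 (n - k)|
      ≤ ((par n : ℕ) : ℝ) / 6 * ∑ k ∈ range n, ℓ (k + 1) * ℓ (n - k) := by
    refine mul_le_mul_of_nonneg_left (sum_le_sum fun k hk => ?_) (by positivity)
    rw [mem_range] at hk
    exact mul_le_mul (haℓ (k + 1) (by omega)) (haℓ (n - k) (by omega)) (ha0 _) (hℓ0 (k + 1) (by omega))
  -- assemble the real bound
  have hB : (|r - 1| + |2 - r| * n) * |w r 1 n|
        + (∑ k ∈ range n, (if k = 0 then (0 : ℝ) else cc (k + 1) * |w r 1 (k + 1)|)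
            * ((n - k : ℕ) : ℝ) * |w r 1 (n - k)|)
        + ((par n : ℕ) : ℝ) / 6 * ∑ k ∈ range n, |w r 1 (k + 1)| * |w r 1 (n - k)|
      ≤ ((ρn : ℝ) / d + (νn : ℝ) / d * n) * ℓ n
        + ∑ k ∈ range n, ((if k = 0 then (0 : ℝ) else cc (k + 1) * ((n - k : ℕ) : ℝ)) + ((par n : ℕ) : ℝ) / 6)
            * (ℓ (k + 1) * ℓ (n - k)) := by
    have e : ((ρn : ℝ) / d + (νn : ℝ) / d * n) * ℓ n
        + ∑ k ∈ range n, ((if k = 0 then (0 : ℝ) else cc (k + 1) * ((n - k : ℕ) : ℝ)) + ((par n : ℕ) : ℝ) / 6)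
            * (ℓ (k + 1) * ℓ (n - k))
        = ((ρn : ℝ) / d + (νn : ℝ) / d * n) * ℓ n
          + (∑ k ∈ range n, (if k = 0 then (0 : ℝ) else cc (k + 1) * ((n - k : ℕ) : ℝ)) * (ℓ (k + 1) * ℓ (n - k)))
          + ((par n : ℕ) : ℝ) / 6 * ∑ k ∈ range n, ℓ (k + 1) * ℓ (n - k) := by
      have : ∀ k ∈ range n, ((if k = 0 then (0 : ℝ) else cc (k + 1) * ((n - k : ℕ) : ℝ)) + ((par n : ℕ) : ℝ) / 6)
            * (ℓ (k + 1) * ℓ (n - k))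
          = (if k = 0 then (0 : ℝ) else cc (k + 1) * ((n - k : ℕ) : ℝ)) * (ℓ (k + 1) * ℓ (n - k))
            + ((par n : ℕ) : ℝ) / 6 * (ℓ (k + 1) * ℓ (n - k)) :=
        fun k _ => by ring
      rw [sum_congr rfl this, sum_add_distrib, mul_sum]; ring
    rw [e]
    exact add_le_add (add_le_add hlin hmid) hpar
  -- now the integer roundings: X := cdiv((ρn + n ρd) L_n, ρd) ≥ (ρn/ρd + n) L_n, Q := cdiv(quadZ, 2^P) ≥ quadZ/2^P
  have hd' : (0 : ℤ) < (d : ℤ) := by exact_mod_cast hd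
  have hdR : (0 : ℝ) < (d : ℝ) := by exact_mod_cast hd
  have h2Pz : (0 : ℤ) < (2 : ℤ) ^ P := by positivity
  have hX := Numerics.div_le_cdiv (a := ((ρn : ℤ) + (n : ℤ) * νn) * getZ L n) hd'
  have hQ := Numerics.div_le_cdiv (a := quadZ L n) h2Pz
  have hdenz : (0 : ℤ) < (n : ℤ) + 1 + par n := by positivity
  have hT := Numerics.div_le_cdiv
    (a := Numerics.cdiv (((ρn : ℤ) + (n : ℤ) * νn) * getZ L n) d + Numerics.cdiv (quadZ L n) ((2 : ℤ) ^ P)) hdenz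
  -- the quadratic integer sum equals the real sum times 2^(2P)/3^(n+1)… : express ℓ products
  have hquad : (∑ k ∈ range n, ((if k = 0 then (0 : ℝ) else cc (k + 1) * ((n - k : ℕ) : ℝ)) + ((par n : ℕ) : ℝ) / 6)
        * (ℓ (k + 1) * ℓ (n - k)))
      = (quadZ L n : ℝ) * (3 : ℝ) ^ n / ((2 : ℝ) ^ P * (2 : ℝ) ^ P) := by
    unfold quadZ
    rw [sumZ_eq]
    push_cast
    rw [sum_mul, sum_div]
    refine sum_congr rfl fun k hk => ?_
    rw [mem_range] at hk
    have hc3 : (if k = 0 then (0 : ℝ) else ((cc3 (k + 1) : ℤ) : ℝ) * ((n - k : ℕ) : ℝ))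
        = 3 * (if k = 0 then (0 : ℝ) else cc (k + 1) * ((n - k : ℕ) : ℝ)) := by
      split_ifs
      · ring
      · rw [cc3_cast]; ring
    rw [hc3]
    have hpw : (3 : ℝ) ^ (k + 1) * (3 : ℝ) ^ (n - k) = 3 * (3 : ℝ) ^ n := by
      rw [← pow_add, show k + 1 + (n - k) = n + 1 by omega, pow_succ]; ring
    simp only [hℓ]
    rw [par2_cast]
    have e3 : (3 : ℝ) ^ (k + 1) = 3 * (3 : ℝ) ^ k := by rw [pow_succ]; ring
    have e4 : (3 : ℝ) ^ n = (3 : ℝ) ^ k * (3 : ℝ) ^ (n - k) := by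
      rw [← pow_add, show k + (n - k) = n by omega]
    rw [e3, e4]
    field_simp
    ring
  -- final chain
  have hmain : |w r 1 (n + 1)| * (2 : ℝ) ^ P
      ≤ 3 / ((n : ℝ) + 1 + (par n : ℕ)) * ((((ρn : ℝ) / d + (νn : ℝ) / d * n)) * ℓ n
        + (quadZ L n : ℝ) * (3 : ℝ) ^ n / ((2 : ℝ) ^ P * (2 : ℝ) ^ P)) * (2 : ℝ) ^ P := by
    rw [← hquad]
    have := hstep.trans (mul_le_mul_of_nonneg_left hB (by positivity))
    exact mul_le_mul_of_nonneg_right this h2P.le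
  refine hmain.trans ?_
  -- compare with stepZ · 3^(n+1)
  have h3n : (0 : ℝ) < (3 : ℝ) ^ n := by positivity
  have eX : (((ρn : ℝ) / d + (νn : ℝ) / d * n)) * ℓ n * (2 : ℝ) ^ P
      = ((((ρn : ℤ) + (n : ℤ) * νn) * getZ L n : ℤ) : ℝ) / (d : ℤ) * (3 : ℝ) ^ n := by
    simp only [hℓ]; push_cast; field_simp
  have hX' : (((ρn : ℝ) / d + (νn : ℝ) / d * n)) * ℓ n * (2 : ℝ) ^ P
      ≤ ((Numerics.cdiv (((ρn : ℤ) + (n : ℤ) * νn) * getZ L n) d : ℤ) : ℝ) * (3 : ℝ) ^ n := by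
    rw [eX]; exact mul_le_mul_of_nonneg_right (by exact_mod_cast hX) h3n.le
  have hQ' : (quadZ L n : ℝ) * (3 : ℝ) ^ n / ((2 : ℝ) ^ P * (2 : ℝ) ^ P) * (2 : ℝ) ^ P
      ≤ ((Numerics.cdiv (quadZ L n) ((2 : ℤ) ^ P) : ℤ) : ℝ) * (3 : ℝ) ^ n := by
    have e : (quadZ L n : ℝ) * (3 : ℝ) ^ n / ((2 : ℝ) ^ P * (2 : ℝ) ^ P) * (2 : ℝ) ^ P
        = (quadZ L n : ℝ) / (((2 : ℤ) ^ P : ℤ) : ℝ) * (3 : ℝ) ^ n := by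
      push_cast; field_simp
    rw [e]; exact mul_le_mul_of_nonneg_right (by exact_mod_cast hQ) h3n.le
  have hsum : ((((ρn : ℝ) / d + (νn : ℝ) / d * n)) * ℓ n + (quadZ L n : ℝ) * (3 : ℝ) ^ n / ((2 : ℝ) ^ P * (2 : ℝ) ^ P))
        * (2 : ℝ) ^ P
      ≤ ((Numerics.cdiv (((ρn : ℤ) + (n : ℤ) * νn) * getZ L n) d + Numerics.cdiv (quadZ L n) ((2 : ℤ) ^ P) : ℤ) : ℝ)
          * (3 : ℝ) ^ n := by
    have e1 : ((((ρn : ℝ) / d + (νn : ℝ) / d * n)) * ℓ n + (quadZ L n : ℝ) * (3 : ℝ) ^ n / ((2 : ℝ) ^ P * (2 : ℝ) ^ P))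
          * (2 : ℝ) ^ P
        = (((ρn : ℝ) / d + (νn : ℝ) / d * n)) * ℓ n * (2 : ℝ) ^ P
          + (quadZ L n : ℝ) * (3 : ℝ) ^ n / ((2 : ℝ) ^ P * (2 : ℝ) ^ P) * (2 : ℝ) ^ P := by ring
    have e2 : ((Numerics.cdiv (((ρn : ℤ) + (n : ℤ) * νn) * getZ L n) d + Numerics.cdiv (quadZ L n) ((2 : ℤ) ^ P) : ℤ) : ℝ)
          * (3 : ℝ) ^ n
        = ((Numerics.cdiv (((ρn : ℤ) + (n : ℤ) * νn) * getZ L n) d : ℤ) : ℝ) * (3 : ℝ) ^ n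
          + ((Numerics.cdiv (quadZ L n) ((2 : ℤ) ^ P) : ℤ) : ℝ) * (3 : ℝ) ^ n := by
      rw [Int.cast_add]; ring
    rw [e1, e2]; exact add_le_add hX' hQ'
  have hdenR : ((((n : ℤ) + 1 + par n : ℤ)) : ℝ) = (n : ℝ) + 1 + (par n : ℕ) := by push_cast; ring
  calc 3 / ((n : ℝ) + 1 + (par n : ℕ)) * ((((ρn : ℝ) / d + (νn : ℝ) / d * n)) * ℓ n
        + (quadZ L n : ℝ) * (3 : ℝ) ^ n / ((2 : ℝ) ^ P * (2 : ℝ) ^ P)) * (2 : ℝ) ^ P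
      = 3 / ((n : ℝ) + 1 + (par n : ℕ)) * (((((ρn : ℝ) / d + (νn : ℝ) / d * n)) * ℓ n
        + (quadZ L n : ℝ) * (3 : ℝ) ^ n / ((2 : ℝ) ^ P * (2 : ℝ) ^ P)) * (2 : ℝ) ^ P) := by ring
    _ ≤ 3 / ((n : ℝ) + 1 + (par n : ℕ)) *
        (((Numerics.cdiv (((ρn : ℤ) + (n : ℤ) * νn) * getZ L n) d + Numerics.cdiv (quadZ L n) ((2 : ℤ) ^ P) : ℤ) : ℝ)
          * (3 : ℝ) ^ n) := mul_le_mul_of_nonneg_left hsum (by positivity)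
    _ = (((Numerics.cdiv (((ρn : ℤ) + (n : ℤ) * νn) * getZ L n) d + Numerics.cdiv (quadZ L n) ((2 : ℤ) ^ P) : ℤ) : ℝ)
          / ((((n : ℤ) + 1 + par n : ℤ)) : ℝ)) * (3 : ℝ) ^ (n + 1) := by
        rw [hdenR, pow_succ]; field_simp
    _ ≤ (stepZ ρn νn d P L n : ℝ) * (3 : ℝ) ^ (n + 1) := by
        unfold stepZ
        exact mul_le_mul_of_nonneg_right hT (by positivity)

/-- **Soundness of the restarted scalar majorant**: if the head data dominate `|w_j| 2^P / 3^j` for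
`j < |H|` (and `|H| ≥ 1`), then so does every entry of `majList`. [cite: BuckmasterCaolaboraGomezserrano2025, proof of Prop. 2.5] -/
theorem abs_w_le_majList {r : ℝ} (hd : 0 < d) (hr : |r - 1| ≤ (ρn : ℝ) / d) (hν : |2 - r| ≤ (νn : ℝ) / d)
    (hH : 0 < H.length)
    (hhead : ∀ j, j < H.length → |w r 1 j| * (2 : ℝ) ^ P ≤ (getZ H j : ℝ) * (3 : ℝ) ^ j) :
    ∀ m j, j < H.length + m → |w r 1 j| * (2 : ℝ) ^ P ≤ (getZ (majList ρn νn d P H m) j : ℝ) * (3 : ℝ) ^ j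
  | 0, j, hj => by simpa [majList] using hhead j (by simpa using hj)
  | m + 1, j, hj => by
      rcases Nat.lt_or_ge j (H.length + m) with hlt | hge
      · rw [getZ_majList_of_lt hlt]
        exact abs_w_le_majList hd hr hν hH hhead m j hlt
      · have hjeq : j = H.length + m := by omega
        subst hjeq
        rw [getZ_majList_last m]
        obtain ⟨n, hn⟩ : ∃ n, H.length + m = n + 1 := ⟨H.length + m - 1, by omega⟩
        rw [hn, show n + 1 - 1 = n from rfl]
        refine abs_w_succ_le_stepZ hd hr hν fun i hi => ?_
        exact abs_w_le_majList hd hr hν hH hhead m i (by omega)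

end OriginSeries

end BuckmasterCaolaboraGomezserrano2025

end Literature.Analysis.FluidPDE
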